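import Mathlib
import HarnessLib
import Summits.NavierStokesRegularity.NavierStokesRegularity.Theorems.UnthreadedRigidityDoorUnthreadedRigiditySpectralEdgeHalfLaplacianInjective

/-!
# Route `UnthreadedRigidityDoor`, wall item W2 `UnthreadedRigidity` (stmt-NavierStokesRegularity-27585) — LINES g13-1/g13-2 (ns-idea-6 g13,
# `SpectralEdge_sketch.lean`, `EdgeCoercive_sketch.lean` v1.4): the two remaining pointwise typed Props BY NAME —
# `AngularLemmaSphere` and `EdgeCoercive l` (every `l`), VERBATIM (sketch-local `edgeForm` / `hessSq` / `gradSq` unfolded)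

Seat ns-es-p1 g9.  Corollaries of the landed chain: `AngularLemmaSphere` (the tree's angular lemma with its hypothesis only on the unit sphere:
cone property `ThreadingJets.angForm_smul` + `angularLemma_holds`) and `EdgeCoercive l` («edge-flat ⇒ angular-flat» on the unit sphere:
`edgeHalfLaplacian` + `halfLaplacianInjective`), so that every pointwise typed Prop of the two sketches is a tree theorem; the integral statements
(`EdgeIntegralIdentity`, `EdgeInequality`, `EdgeSharpCoercivity`, `EdgeCoercivityConstant`) and `InfinitesimalEdgeRigidity` are NOT touched.

HONEST LABEL: supports of a files-only RUNG line two levels below W2; nothing here bears on `UnthreadedRigidity` (27585), the door Target, W2 or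
Navier–Stokes regularity; no summit statement is proved.  0 kit.  [folklore]
-/

noncomputable section

-- the summit and its single sub-problem share the name (CONVENTIONS §1), as in every Theorems file
set_option linter.dupNamespace false

namespace Summit.NavierStokesRegularity.NavierStokesRegularity.Theorems.UnthreadedRigidity.SpectralEdge

open scoped RealInnerProductSpace
open Summit.NavierStokesRegularity.NavierStokesRegularity.Theorems.UnthreadedRigidity.ProfileHorn (E3)
open Summit.NavierStokesRegularity.NavierStokesRegularity.Theorems.UnthreadedRigidity.VirialHorn

/-- the cone property: if `{Y,|∇Y|²}` vanishes on the unit sphere it vanishes everywhere. [folklore] -/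
theorem angForm_eq_zero_of_sphere {l : ℕ} {Y : E3 → ℝ} (hY : IsSolidHarmonic l Y)
    (h : ∀ y : E3, ‖y‖ = 1 → angForm Y y = 0) (y : E3) : angForm Y y = 0 := by
  rcases eq_or_ne y 0 with hy | hy
  · subst hy
    simp [angForm, pbr, det3]
  · have hn : 0 < ‖y‖ := norm_pos_iff.2 hy
    set u : E3 := ‖y‖⁻¹ • y with hu
    have hun : ‖u‖ = 1 := by rw [hu, norm_smul, norm_inv, norm_norm, inv_mul_cancel₀ hn.ne']
    have hyu : y = ‖y‖ • u := by rw [hu, smul_smul, mul_inv_cancel₀ hn.ne', one_smul]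
    rw [hyu, ThreadingJets.angForm_smul hY hn u, h u hun, mul_zero]

/-- ★ **the sketch's `AngularLemmaSphere` VERBATIM**: the angular lemma with its hypothesis only on the unit sphere — a solid harmonic whose angular
form `{Y,|∇Y|²}` vanishes on `S²` is zonal (cone property + the tree's `angularLemma_holds`). -/
theorem angularLemmaSphere :
    ∀ (l : ℕ) (Y : E3 → ℝ), IsSolidHarmonic l Y → (∀ y : E3, ‖y‖ = 1 → angForm Y y = 0) → IsZonal Y :=
  fun l Y hY h => angularLemma_holds l Y hY (angForm_eq_zero_of_sphere hY h)

/-- ★ **the sketch's `EdgeCoercive l` VERBATIM** (sketch-local `edgeForm` / `hessSq` / `gradSq` unfolded), every degree: «edge-flat ⇒ angular-flat»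
on the unit sphere (`edgeHalfLaplacian` + `halfLaplacianInjective`; the sketch's `edgeCoercive_of_halfLaplacian` with both hypotheses discharged). -/
theorem edgeCoercive (l : ℕ) :
    ∀ Y : E3 → ℝ, IsSolidHarmonic l Y →
      (∀ y : E3, ‖y‖ = 1 →
        lap3 (angForm Y) y - (4 * (l : ℝ) ^ 2 - 20 * (l : ℝ) + 6) * angForm Y y
          - 2 * pbr Y (fun z => (∑ i : Fin 3, ‖fderiv ℝ (gradient Y) z (e i)‖ ^ 2)
              - 2 * ((l : ℝ) - 1) ^ 2 * ‖gradient Y z‖ ^ 2) y = 0) →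
      ∀ y : E3, ‖y‖ = 1 → angForm Y y = 0 :=
  fun Y hY hE => halfLaplacianInjective l Y hY (fun y hy => by rw [← edgeHalfLaplacian l Y hY y]; exact hE y hy)

end Summit.NavierStokesRegularity.NavierStokesRegularity.Theorems.UnthreadedRigidity.SpectralEdge

end
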